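import Summits.KontsevichZagierPeriods.KontsevichZagierPeriods.Theorems.RootDecompQuadraticDescentPair18HomotopyP11

/-! # `RootDecompQuadraticDescentPair18HomotopyP12` — part 12/31 of the mechanical ≤400-line split of `Pair18Homotopy_v14_noguard.lean` (sha256 72e9c8442b4af820…)
Source: decomp-kz lens-6 g9 `Pair18Homotopy.lean` v14 (HOME/decomp-kz-lens-6/g9/, sha256 3dda3232…; critic g4-48/g4-53/g4-56/g5 CLEARED; census pair #18 of crux stmt-KontsevichZagierPeriods-28994: homotopy cells, duplications, inversions, Euler–Landen, arc/angle regions; terminal `pair18_g8strips_of_grid : hEuler → hGrid → hAng4 → (g8 form of #18)`); `#guard_msgs … #print axioms` pins removed for landing.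
Split by census-1 g9 `gen/splitlean.py`: scopes re-opened with their `open`/`variable`/`set_option` context; mathematics and declaration order unchanged. -/

set_option linter.unusedSimpArgs false
noncomputable section
open _root_.Set MvPolynomial
namespace Summit.KontsevichZagierPeriods.RootDecompQuadraticDescent.Pair18Homotopy
open Literature.NumberTheory.Transcendental
open Literature.NumberTheory.Transcendental.KZ (RFun cube)
open Summit.KontsevichZagierPeriods.RootDecompQuadraticDescent.DarkPairs (rel_reflect_rep rel_double)
/-- Auxiliary step `vec2_1` (§2b): vec2 1. [bookkeeping] -/
private theorem vec2_1 (a b : ℝ) : (![a, b] : Fin 2 → ℝ) 1 = b := rfl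

/-- Auxiliary step `vec2_0` (§2b): vec2 0. [bookkeeping] -/
private theorem vec2_0 (a b : ℝ) : (![a, b] : Fin 2 → ℝ) 0 = a := rfl

/-- Linearity in the integrand (rule 1b): `T = S + U` pointwise on the square. -/
private theorem rel_lin (T S U : RFun 2) (h : ∀ x ∈ cube 2, T.fn x = S.fn x + U.fn x) :
    KZ.of T.rep - KZ.of S.rep - KZ.of U.rep ∈ KZ.relations :=
  KZ.cubicalLinGens_subset_relations (KZ.mem_cubicalLinGens T.isTameCube_rep S.isTameCube_rep
    U.isTameCube_rep fun x hx => by simpa using h x hx)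

/-- Auxiliary step `cube2` (§0): cube2. [bookkeeping] -/
private theorem cube2 {x : Fin 2 → ℝ} (hx : x ∈ KZ.cube 2) : (0 ≤ x 0 ∧ x 0 ≤ 1) ∧ (0 ≤ x 1 ∧ x 1 ≤ 1) := ⟨hx 0, hx 1⟩

section Landen
open Literature.ModelTheory.ExponentialFields (IsSemialgebraic isSemialgebraic_setOf_eval_le
  isSemialgebraic_setOf_eval_pos)

/-- swap symmetry of the tensor square: `[N|{x ≤ w}] ≡ [N|{w ≤ x}]`. -/
theorem NU_cov : KZ.of NU - KZ.of NL ∈ KZ.relations := by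
  let Φ : (Fin 2 → ℝ) → (Fin 2 → ℝ) := fun z => ![z 1, z 0]
  let Mz : (Fin 2 → ℝ) → Matrix (Fin 2) (Fin 2) ℝ := fun _ => !![0, 1; 1, 0]
  let Φ' : (Fin 2 → ℝ) → (Fin 2 → ℝ) →L[ℝ] (Fin 2 → ℝ) := fun z =>
    LinearMap.toContinuousLinearMap (Matrix.toLin' (Mz z))
  have hΦ'ap : ∀ z w, Φ' z w = ![w 1, w 0] := by
    intro z w; funext i
    fin_cases i <;> simp [Φ', Mz, Matrix.toLin'_apply, Matrix.mulVec, dotProduct, Fin.sum_univ_two]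
  have hdet : ∀ z, (Φ' z).det = -1 := by
    intro z
    unfold ContinuousLinearMap.det
    simp [Φ', LinearMap.det_toLin', Mz, Matrix.det_fin_two]
  have hdom : NL.domain = Φ '' NU.domain := by
    simp only [NL, NU, KZ.IntegralRep.domain_restrict, TriL, TriU]
    ext w
    constructor
    · rintro ⟨hw, hle⟩
      simp only [mem_setOf_eq] at hle
      refine ⟨![w 1, w 0], ⟨?_, ?_⟩, ?_⟩
      · intro i
        fin_cases i
        · simpa using hw 1
        · simpa using hw 0
      · simpa using hle
      · funext i
        fin_cases i
        · simp [Φ]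
        · simp [Φ]
    · rintro ⟨z, ⟨hz, hle⟩, rfl⟩
      simp only [mem_setOf_eq] at hle
      refine ⟨fun i => ?_, ?_⟩
      · fin_cases i
        · simpa [Φ] using hz 1
        · simpa [Φ] using hz 0
      · simpa [Φ] using hle
  refine KZ.changeOfVariablesRel_subset_relations ⟨2, NU, NL, Φ, Φ', ?_, ?_, ?_, hdom, ?_, rfl⟩
  · have hsd : IsSemialgebraic ℚ NU.domain := NU.isSemialgebraic_domain
    refine (isSemialgebraicMapOn_iff_forall_holds hsd).mpr fun i => ?_
    fin_cases i
    · exact (isSemialgebraicFunOn_aeval hsd (X 1)).congr fun z _ => by simp [Φ]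
    · exact (isSemialgebraicFunOn_aeval hsd (X 0)).congr fun z _ => by simp [Φ]
  · intro z hz
    have h0 : HasFDerivAt (fun w : Fin 2 → ℝ => w 1)
        (ContinuousLinearMap.proj (R := ℝ) (φ := fun _ : Fin 2 => ℝ) 1) z := hasFDerivAt_apply 1 z
    have h1 : HasFDerivAt (fun w : Fin 2 → ℝ => w 0)
        (ContinuousLinearMap.proj (R := ℝ) (φ := fun _ : Fin 2 => ℝ) 0) z := hasFDerivAt_apply 0 z
    have hpi : HasFDerivAt Φ (Φ' z) z := by
      rw [hasFDerivAt_pi']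
      intro i
      fin_cases i
      · have e : (ContinuousLinearMap.proj (R := ℝ) (φ := fun _ : Fin 2 => ℝ) 0).comp (Φ' z) =
            ContinuousLinearMap.proj (R := ℝ) (φ := fun _ : Fin 2 => ℝ) 1 := by
          ext w; simp [hΦ'ap]
        simpa [e, Φ] using h0
      · have e : (ContinuousLinearMap.proj (R := ℝ) (φ := fun _ : Fin 2 => ℝ) 1).comp (Φ' z) =
            ContinuousLinearMap.proj (R := ℝ) (φ := fun _ : Fin 2 => ℝ) 0 := by
          ext w; simp [hΦ'ap]
        simpa [e, Φ] using h1
    exact hpi.hasFDerivWithinAt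
  · intro z₁ hz₁ z₂ hz₂ heq
    have e0 : z₁ 1 = z₂ 1 := by simpa [Φ] using congrFun heq 0
    have e1 : z₁ 0 = z₂ 0 := by simpa [Φ] using congrFun heq 1
    funext i
    fin_cases i
    · exact e1
    · exact e0
  · intro z hz
    rw [hdet z]
    simp only [NU, NL, KZ.IntegralRep.integrand_restrict, RFun.rep_integrand, abs_neg, abs_one, mul_one]
    simp only [N, NDen, RFun.fn, Φ, map_add, map_sub, map_mul, map_pow, map_neg, aeval_C, aeval_X, map_one, map_ofNat, eq_ratCast, Rat.cast_one, Rat.cast_ofNat, Rat.cast_div, Rat.cast_neg, vec2_0, vec2_1, Matrix.cons_val_zero, Matrix.cons_val_one, Matrix.head_cons]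
    ring_nf

/-- Auxiliary step `add_N`: add N. [bookkeeping] -/
theorem add_N : KZ.of N.rep - KZ.of NL - KZ.of NU ∈ KZ.relations := by
  refine KZ.domainAddRel_subset_relations ⟨2, N.rep, NL, NU, ?_, ?_, fun _ _ => rfl, fun _ _ => rfl, rfl⟩
  · simp only [NL, NU, KZ.IntegralRep.domain_restrict, RFun.rep_domain, TriL, TriU]
    ext z
    simp only [mem_union, mem_inter_iff, mem_setOf_eq]
    constructor
    · intro hz
      rcases le_total (z 1) (z 0) with h | h
      · exact Or.inl ⟨hz, h⟩
      · exact Or.inr ⟨hz, h⟩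
    · rintro (⟨hz, _⟩ | ⟨hz, _⟩) <;> exact hz
  · refine MeasureTheory.measure_mono_null ?_ volume_diag
    simp only [NL, NU, KZ.IntegralRep.domain_restrict, TriL, TriU]
    rintro z ⟨⟨_, h1⟩, ⟨_, h2⟩⟩
    simp only [mem_setOf_eq] at h1 h2 ⊢
    exact le_antisymm h2 h1

/-- `[Lbox] ≡ 2•[Lq]` (`log²2 = 2·½log²2` as a congruence). -/
theorem Lbox_Lq : KZ.of Lbox.rep - 2 • KZ.of Lq.rep ∈ KZ.relations := by
  have e : KZ.of Lbox.rep - 2 • KZ.of Lq.rep = (KZ.of Lbox.rep - KZ.of N₁.rep) + (KZ.of N₁.rep - KZ.of N.rep)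
      + (KZ.of N.rep - KZ.of NL - KZ.of NU) + (KZ.of NU - KZ.of NL)
      - 2 • ((KZ.of Lq.rep - KZ.of LqP) + (KZ.of LqP - KZ.of NLP) - (KZ.of NL - KZ.of NLP)) := by abel
  rw [e]
  exact sub_mem (add_mem (add_mem (add_mem Lbox_N₁ N₁_rel) add_N) NU_cov)
    (nsmul_mem (sub_mem (add_mem Lq_P LqP_cov) NL_P) 2)

/-- `2•([U1] − [U2r]) ≡ [Lbox]`, i.e. `2(π²/12 − Li₂(½)) = log²2`. -/
theorem euler_rel2 : 2 • (KZ.of U1.rep - KZ.of U2r.rep) - KZ.of Lbox.rep ∈ KZ.relations := by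
  have e : 2 • (KZ.of U1.rep - KZ.of U2r.rep) - KZ.of Lbox.rep =
      2 • (KZ.of U1.rep - KZ.of U2r.rep - KZ.of Lq.rep) - (KZ.of Lbox.rep - 2 • KZ.of Lq.rep) := by abel
  rw [e]
  exact sub_mem (nsmul_mem euler_rel 2) Lbox_Lq

end Landen

/-! ## §7 The sharpened residual: hElem with the two weight-two `log²2` brackets eliminated

With §5–§6 the hypothesis of `pair18_g8strips_of_elem` loses `[U2r]` (Euler–Landen) and `[E0]+[Ax1]−[U1]`
(inversion junk): what remains are the five `arctan √7`-type brackets `[Gm], [Gp], 2[Sp]+2[Sm]+[M2], [Crit1],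
[Crit2]` against the explicit standard boxes `[Ax0]` (`= π²/24`), `[Lq]` (`= ½log²2`) and the triangle `[M|T]`
(`= ¼log²2`). -/
section Residual

/-- the inversion bracket is congruent to the explicit triangle box `[M|T] = ∫∫_{2w̃ ≤ t} dw̃dt/((1+t)(1+2w̃))`. -/
theorem inv0_tri : KZ.of E0.rep + KZ.of Ax1.rep - KZ.of U1.rep - KZ.of MT ∈ KZ.relations := by
  have e : KZ.of E0.rep + KZ.of Ax1.rep - KZ.of U1.rep - KZ.of MT =
      (KZ.of Ax1.rep - KZ.of Ax0.rep - KZ.of Ahi.rep) - (KZ.of Ax0.rep - KZ.of E0.rep - KZ.of Bhi.rep)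
        - (KZ.of U1.rep - 2 • KZ.of Ax0.rep) + (KZ.of Ahi.rep - KZ.of Av.rep) - (KZ.of Bm.rep - KZ.of Bv.rep)
        + (KZ.of Bm.rep - KZ.of Bref.rep) + (KZ.of Bref.rep - KZ.of Bhi.rep) + (KZ.of Av.rep - KZ.of MΩ)
        - (KZ.of Bv.rep - KZ.of MΩB) + (KZ.of MΩ - KZ.of MT - KZ.of MΩB) := by abel
  rw [e]
  exact add_mem (sub_mem (add_mem (add_mem (add_mem (sub_mem (add_mem (sub_mem (sub_mem Ax1_split Ax0_split) U1_Ax0)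
    Ahi_sq) Bm_sq) Bm_rel) Bref_rel) Av_cov) Bv_cov) add_Ω

/-- **#18 reduced to five arctan-type evaluations.**  `hElem5` is hElem of `pair18_g8strips_of_elem` with
`[U2r]` replaced by `2[Ax0] − [Lq]` (`euler_rel`, `U1_Ax0`) and `[E0]+[Ax1]−[U1]` by `[M|T]` (`inv0_tri`). -/
theorem pair18_g8strips_of_elem5
    (hElem5 : 4 • KZ.of Gm.rep + 2 • KZ.of Gp.rep + 2 • (2 • KZ.of Sp.rep + 2 • KZ.of Sm.rep + KZ.of M2.rep)
      + 10 • KZ.of Crit1.rep - KZ.of Crit2.rep - 42 • KZ.of Ax0.rep + 21 • KZ.of Lq.rep - KZ.of MT ∈ KZ.relations) :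
    KZ.of U1.rep - KZ.of U2r.rep + KZ.of SL.rep - 2 • KZ.of K12c.rep + 2 • KZ.of Kh.rep ∈ KZ.relations := by
  refine pair18_g8strips_of_elem ?_
  have e : 4 • KZ.of Gm.rep + 2 • KZ.of Gp.rep + 2 • (2 • KZ.of Sp.rep + 2 • KZ.of Sm.rep + KZ.of M2.rep)
      + 10 • KZ.of Crit1.rep - KZ.of Crit2.rep - 21 • KZ.of U2r.rep - (KZ.of E0.rep + KZ.of Ax1.rep - KZ.of U1.rep) =
      (4 • KZ.of Gm.rep + 2 • KZ.of Gp.rep + 2 • (2 • KZ.of Sp.rep + 2 • KZ.of Sm.rep + KZ.of M2.rep)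
      + 10 • KZ.of Crit1.rep - KZ.of Crit2.rep - 42 • KZ.of Ax0.rep + 21 • KZ.of Lq.rep - KZ.of MT)
      + 21 • (KZ.of U1.rep - KZ.of U2r.rep - KZ.of Lq.rep) - 21 • (KZ.of U1.rep - 2 • KZ.of Ax0.rep)
      - (KZ.of E0.rep + KZ.of Ax1.rep - KZ.of U1.rep - KZ.of MT) := by abel
  rw [e]
  exact sub_mem (sub_mem (add_mem hElem5 (nsmul_mem euler_rel 21)) (nsmul_mem U1_Ax0 21)) inv0_tri

/-- the same with the (C′) strip conclusion of §3. -/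
theorem pair18_strips_of_elem5
    (hElem5 : 4 • KZ.of Gm.rep + 2 • KZ.of Gp.rep + 2 • (2 • KZ.of Sp.rep + 2 • KZ.of Sm.rep + KZ.of M2.rep)
      + 10 • KZ.of Crit1.rep - KZ.of Crit2.rep - 42 • KZ.of Ax0.rep + 21 • KZ.of Lq.rep - KZ.of MT ∈ KZ.relations) :
    KZ.of U1.rep - KZ.of U2r.rep + KZ.of SL.rep - 2 • (KZ.of Sp.rep + KZ.of Sm.rep) + 2 • (KZ.of Shp.rep + KZ.of Shm.rep)
      ∈ KZ.relations := by
  refine pair18_strips_of_elem ?_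
  have e : 4 • KZ.of Gm.rep + 2 • KZ.of Gp.rep + 2 • (2 • KZ.of Sp.rep + 2 • KZ.of Sm.rep + KZ.of M2.rep)
      + 10 • KZ.of Crit1.rep - KZ.of Crit2.rep - 21 • KZ.of U2r.rep - (KZ.of E0.rep + KZ.of Ax1.rep - KZ.of U1.rep) =
      (4 • KZ.of Gm.rep + 2 • KZ.of Gp.rep + 2 • (2 • KZ.of Sp.rep + 2 • KZ.of Sm.rep + KZ.of M2.rep)
      + 10 • KZ.of Crit1.rep - KZ.of Crit2.rep - 42 • KZ.of Ax0.rep + 21 • KZ.of Lq.rep - KZ.of MT)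
      + 21 • (KZ.of U1.rep - KZ.of U2r.rep - KZ.of Lq.rep) - 21 • (KZ.of U1.rep - 2 • KZ.of Ax0.rep)
      - (KZ.of E0.rep + KZ.of Ax1.rep - KZ.of U1.rep - KZ.of MT) := by abel
  rw [e]
  exact sub_mem (sub_mem (add_mem hElem5 (nsmul_mem euler_rel 21)) (nsmul_mem U1_Ax0 21)) inv0_tri

end Residual

/-! ## §8 The critical line: `[Crit1]` DECIDED modulo the standard `θ²` box (`4•[Crit1] − 4•[Th7] + 3•[Lbox] ∈ KZ.relations`)

`Crit1 = Θ(−1,2) − Θ(−1,¼) = ∫∫ (7/4)x/(1−x+mx²)`, `m = (1+7t)/4`.  The Möbius self-map `x = 2b/(1+b)` (`rel_moeb`)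
RATIONALISES the critical pencil: `1 − x + m x² = (1 + 7t b²)/(1+b)²`, so `[Crit1] ≡ [7b/((1+b)(1+7tb²))]`, whose
partial fractions are the arctan box `Th7 = [7/((1+7t)(1+7tb²))]` (`= arctan²√7 = θ²`, our STANDARD θ² box) and two
`log` boxes: `CL2 = [7/((1+7t)(1+b))] ≡ 3•[Lbox]` (three affine pieces `1+7t ∈ [1,2],[2,4],[4,8]`, generic
`rel_split7`) and `CL1 = [49tb/((1+7t)(1+7tb²))]` with `4•[CL1] ≡ 9•[Lbox]` (`rel_sq`, degenerate shear to the
half-square triangle of the tensor square `[49/((1+7w)(1+7t))] ≡ 9•[Lbox]`). -/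
section Arc

open Literature.ModelTheory.ExponentialFields (IsSemialgebraic isSemialgebraic_setOf_eval_le
  isSemialgebraic_setOf_eval_pos)

/-- Auxiliary definition `C1bDen` (§8): C1b Den. [bookkeeping] -/
def C1bDen : MvPolynomial (Fin 2) ℚ := (C 1 + X 0) * (C 1 + C 7 * X 1 * X 0 * X 0)
/-- Auxiliary step `C1bDen_pos` (§8): C1b Den pos. [bookkeeping] -/
theorem C1bDen_pos {x : Fin 2 → ℝ} (hx : x ∈ KZ.cube 2) : 0 < aeval x C1bDen := by
  obtain ⟨h0, h1⟩ := cube2 hx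
  simp only [map_add, map_sub, map_mul, map_pow, map_neg, aeval_C, aeval_X, map_one, map_ofNat, eq_ratCast, Rat.cast_one, Rat.cast_ofNat, Rat.cast_div, Rat.cast_neg, vec2_0, vec2_1, Matrix.cons_val_zero, Matrix.cons_val_one, Matrix.head_cons, C1bDen]
  have : (0:ℝ) < 1 + x 0 := by linarith
  have : (0:ℝ) < 1 + 7 * x 1 * x 0 * x 0 := by nlinarith [mul_nonneg h1.1 (mul_nonneg h0.1 h0.1)]
  positivity
/-- the rationalised critical strip `[7b/((1+b)(1+7tb²))]`. -/
def Crit1b : RFun 2 := ⟨C 7 * X 0, C1bDen, fun _ hx => (C1bDen_pos hx).ne'⟩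
/-- Auxiliary definition `Th7Den` (§8): Th7 Den. [bookkeeping] -/
def Th7Den : MvPolynomial (Fin 2) ℚ := (C 1 + C 7 * X 1) * (C 1 + C 7 * X 1 * X 0 * X 0)
/-- Auxiliary step `Th7Den_pos` (§8): Th7 Den pos. [bookkeeping] -/
theorem Th7Den_pos {x : Fin 2 → ℝ} (hx : x ∈ KZ.cube 2) : 0 < aeval x Th7Den := by
  obtain ⟨h0, h1⟩ := cube2 hx
  simp only [map_add, map_sub, map_mul, map_pow, map_neg, aeval_C, aeval_X, map_one, map_ofNat, eq_ratCast, Rat.cast_one, Rat.cast_ofNat, Rat.cast_div, Rat.cast_neg, vec2_0, vec2_1, Matrix.cons_val_zero, Matrix.cons_val_one, Matrix.head_cons, Th7Den]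
  have : (0:ℝ) < 1 + 7 * x 1 := by linarith
  have : (0:ℝ) < 1 + 7 * x 1 * x 0 * x 0 := by nlinarith [mul_nonneg h1.1 (mul_nonneg h0.1 h0.1)]
  positivity
/-- **the standard `θ²` box** `Th7 = [□², 7/((1+7t)(1+7tb²))] = arctan²√7`. -/
def Th7 : RFun 2 := ⟨C 7, Th7Den, fun _ hx => (Th7Den_pos hx).ne'⟩
/-- Auxiliary definition `CL1` (§8): CL1. [bookkeeping] -/
def CL1 : RFun 2 := ⟨C 49 * X 1 * X 0, Th7Den, fun _ hx => (Th7Den_pos hx).ne'⟩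
/-- Auxiliary definition `S1` (§8): S1. [bookkeeping] -/
def S1 : RFun 2 := ⟨C 7 + C 49 * X 1 * X 0, Th7Den, fun _ hx => (Th7Den_pos hx).ne'⟩
/-- Auxiliary definition `CL2Den` (§8): CL2 Den. [bookkeeping] -/
def CL2Den : MvPolynomial (Fin 2) ℚ := (C 1 + C 7 * X 1) * (C 1 + X 0)
/-- Auxiliary step `CL2Den_pos` (§8): CL2 Den pos. [bookkeeping] -/
theorem CL2Den_pos {x : Fin 2 → ℝ} (hx : x ∈ KZ.cube 2) : 0 < aeval x CL2Den := by
  obtain ⟨h0, h1⟩ := cube2 hx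
  simp only [map_add, map_sub, map_mul, map_pow, map_neg, aeval_C, aeval_X, map_one, map_ofNat, eq_ratCast, Rat.cast_one, Rat.cast_ofNat, Rat.cast_div, Rat.cast_neg, vec2_0, vec2_1, Matrix.cons_val_zero, Matrix.cons_val_one, Matrix.head_cons, CL2Den]
  have : (0:ℝ) < 1 + 7 * x 1 := by linarith
  have : (0:ℝ) < 1 + x 0 := by linarith
  positivity
/-- Auxiliary definition `CL2` (§8): CL2. [bookkeeping] -/
def CL2 : RFun 2 := ⟨C 7, CL2Den, fun _ hx => (CL2Den_pos hx).ne'⟩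

/-- `[Crit1b] ≡ [Crit1]`: the Möbius map rationalises the critical pencil. -/
theorem Crit1b_rel : KZ.of Crit1b.rep - KZ.of Crit1.rep ∈ KZ.relations := by
  refine rel_moeb Crit1b Crit1 fun z hz => ?_
  obtain ⟨h0, h1⟩ := cube2 hz
  have ha : (0 : ℝ) < 1 + z 0 := by linarith
  have hb : (0 : ℝ) < 1 + 7 * z 1 * z 0 * z 0 := by nlinarith [mul_nonneg h1.1 (mul_nonneg h0.1 h0.1)]
  simp only [Crit1b, Crit1, C1bDen, Crit1Den, RFun.fn, map_add, map_sub, map_mul, map_pow, map_neg, aeval_C, aeval_X, map_one, map_ofNat, eq_ratCast, Rat.cast_one, Rat.cast_ofNat, Rat.cast_div, Rat.cast_neg, vec2_0, vec2_1, Matrix.cons_val_zero, Matrix.cons_val_one, Matrix.head_cons]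
  have e : (1 : ℝ) - 2 * z 0 / (1 + z 0) + (1 / 4 + 7 / 4 * z 1) * (2 * z 0 / (1 + z 0)) * (2 * z 0 / (1 + z 0))
      = (1 + 7 * z 1 * z 0 * z 0) / (1 + z 0) ^ 2 := by
    field_simp; ring
  rw [e]
  field_simp
  ring

/-- Auxiliary step `S1_a` (§8): S1 a. [bookkeeping] -/
theorem S1_a : KZ.of S1.rep - KZ.of Th7.rep - KZ.of CL1.rep ∈ KZ.relations := by
  refine rel_lin S1 Th7 CL1 fun z hz => ?_
  simp only [S1, Th7, CL1, RFun.fn, map_add, map_sub, map_mul, map_pow, map_neg, aeval_C, aeval_X, map_one, map_ofNat, eq_ratCast, Rat.cast_one, Rat.cast_ofNat, Rat.cast_div, Rat.cast_neg, vec2_0, vec2_1, Matrix.cons_val_zero, Matrix.cons_val_one, Matrix.head_cons]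
  rw [add_div]

/-- Auxiliary step `S1_b` (§8): S1 b. [bookkeeping] -/
theorem S1_b : KZ.of S1.rep - KZ.of Crit1b.rep - KZ.of CL2.rep ∈ KZ.relations := by
  refine rel_lin S1 Crit1b CL2 fun z hz => ?_
  obtain ⟨h0, h1⟩ := cube2 hz
  have ha : (0 : ℝ) < 1 + z 0 := by linarith
  have hb : (0 : ℝ) < 1 + 7 * z 1 * z 0 * z 0 := by nlinarith [mul_nonneg h1.1 (mul_nonneg h0.1 h0.1)]
  have hc : (0 : ℝ) < 1 + 7 * z 1 := by linarith
  have hb' : (0 : ℝ) < 1 + 7 * z 1 * z 0 ^ 2 := by nlinarith [mul_nonneg h1.1 (mul_nonneg h0.1 h0.1)]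
  simp only [S1, Crit1b, CL2, Th7Den, C1bDen, CL2Den, RFun.fn, map_add, map_sub, map_mul, map_pow, map_neg, aeval_C, aeval_X, map_one, map_ofNat, eq_ratCast, Rat.cast_one, Rat.cast_ofNat, Rat.cast_div, Rat.cast_neg, vec2_0, vec2_1, Matrix.cons_val_zero, Matrix.cons_val_one, Matrix.head_cons]
  field_simp
  ring

/-! ### generic: an affine piece of coordinate 1, and the three-piece split `1+7t ∈ [1,2] ∪ [2,4] ∪ [4,8]` -/

/-- change of variables onto an affine slab `P = {(b, a s + c)}` of `T`'s square. -/
theorem cov_affine1 (T S : RFun 2) (a c : ℚ) (ha : (0 : ℝ) < a) (P : Set (Fin 2 → ℝ)) (hP : IsSemialgebraic ℚ P)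
    (hPsub : P ⊆ T.rep.domain)
    (himage : P = (fun z : Fin 2 → ℝ => (![z 0, (a : ℝ) * z 1 + c] : Fin 2 → ℝ)) '' cube 2)
    (h : ∀ z ∈ cube 2, S.fn z = T.fn ![z 0, (a : ℝ) * z 1 + c] * a) :
    KZ.of S.rep - KZ.of (T.rep.restrict P hP hPsub) ∈ KZ.relations := by
  let Φ : (Fin 2 → ℝ) → (Fin 2 → ℝ) := fun z => ![z 0, (a : ℝ) * z 1 + c]
  let Mz : (Fin 2 → ℝ) → Matrix (Fin 2) (Fin 2) ℝ := fun _ => !![1, 0; 0, (a : ℝ)]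
  let Φ' : (Fin 2 → ℝ) → (Fin 2 → ℝ) →L[ℝ] (Fin 2 → ℝ) := fun z =>
    LinearMap.toContinuousLinearMap (Matrix.toLin' (Mz z))
  have hΦ'ap : ∀ z w, Φ' z w = ![w 0, (a : ℝ) * w 1] := by
    intro z w; funext i
    fin_cases i <;> simp [Φ', Mz, Matrix.toLin'_apply, Matrix.mulVec, dotProduct, Fin.sum_univ_two]
  have hdet : ∀ z, (Φ' z).det = a := by
    intro z
    unfold ContinuousLinearMap.det
    simp [Φ', LinearMap.det_toLin', Mz, Matrix.det_fin_two]
  have hdom : (T.rep.restrict P hP hPsub).domain = Φ '' S.rep.domain := by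
    rw [KZ.IntegralRep.domain_restrict, RFun.rep_domain, himage]
  refine KZ.changeOfVariablesRel_subset_relations ⟨2, S.rep, T.rep.restrict P hP hPsub, Φ, Φ', ?_, ?_, ?_, hdom, ?_, rfl⟩
  · refine (isSemialgebraicMapOn_iff_forall_holds S.rep.isSemialgebraic_domain).mpr fun i => ?_
    fin_cases i
    · exact (isSemialgebraicFunOn_aeval S.rep.isSemialgebraic_domain (X 0)).congr fun z _ => by simp [Φ]
    · exact (isSemialgebraicFunOn_aeval S.rep.isSemialgebraic_domain (C a * X 1 + C c)).congr fun z _ => by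
        simp [Φ, map_add, map_sub, map_mul, map_pow, map_neg, aeval_C, aeval_X, map_one, map_ofNat, eq_ratCast, Rat.cast_one, Rat.cast_ofNat, Rat.cast_div, Rat.cast_neg, vec2_0, vec2_1, Matrix.cons_val_zero, Matrix.cons_val_one, Matrix.head_cons]
  · intro z hz
    have h0 : HasFDerivAt (fun w : Fin 2 → ℝ => w 0)
        (ContinuousLinearMap.proj (R := ℝ) (φ := fun _ : Fin 2 => ℝ) 0) z := hasFDerivAt_apply 0 z
    have h1 : HasFDerivAt (fun w : Fin 2 → ℝ => (a : ℝ) * w 1 + c)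
        ((a : ℝ) • ContinuousLinearMap.proj (R := ℝ) (φ := fun _ : Fin 2 => ℝ) 1) z :=
      ((hasFDerivAt_apply (𝕜 := ℝ) 1 z).const_mul (a : ℝ)).add_const (c : ℝ)
    have hpi : HasFDerivAt Φ (Φ' z) z := by
      rw [hasFDerivAt_pi']
      intro i
      fin_cases i
      · have e : (ContinuousLinearMap.proj (R := ℝ) (φ := fun _ : Fin 2 => ℝ) 0).comp (Φ' z) =
            ContinuousLinearMap.proj (R := ℝ) (φ := fun _ : Fin 2 => ℝ) 0 := by
          ext w; simp [hΦ'ap]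
        simpa [e, Φ] using h0
      · have e : (ContinuousLinearMap.proj (R := ℝ) (φ := fun _ : Fin 2 => ℝ) 1).comp (Φ' z) =
            (a : ℝ) • ContinuousLinearMap.proj (R := ℝ) (φ := fun _ : Fin 2 => ℝ) 1 := by
          ext w; simp [hΦ'ap]
        simpa [e, Φ, Function.comp_def] using h1
    exact hpi.hasFDerivWithinAt
  · intro z₁ hz₁ z₂ hz₂ heq
    have e0 : z₁ 0 = z₂ 0 := by simpa [Φ] using congrFun heq 0
    have e1 : (a : ℝ) * z₁ 1 + c = (a : ℝ) * z₂ 1 + c := by simpa [Φ] using congrFun heq 1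
    have e1' : z₁ 1 = z₂ 1 := by
      have := ha.ne'
      have h2 : (a : ℝ) * z₁ 1 = (a : ℝ) * z₂ 1 := by linarith
      exact mul_left_cancel₀ this h2
    funext i
    fin_cases i
    · exact e0
    · exact e1'
  · intro z hz
    rw [hdet z, abs_of_pos ha, RFun.rep_integrand]
    simp only [KZ.IntegralRep.integrand_restrict, RFun.rep_integrand]
    exact h z hz

end Arc
end Summit.KontsevichZagierPeriods.RootDecompQuadraticDescent.Pair18Homotopy
end
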